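import Summits.QuantumFields.YangMills.Theorems.BalabanUVNodesN15CovariantTwoGridPullbackTwistData
import Summits.QuantumFields.YangMills.Theorems.BalabanUVNodesN15AdjointGaugeAction
import HarnessLib

/-!
# N15 = NE2, road (c) — PROGRAMME (PC) «[B9] Sect. C FOR THE LANDAU LETTER WITH PER-CUBE GAUGES (3.35) AS PRINTED», (PC-E) (C5-c): THE TWIST DATA AT GENUINE `U(m)` BACKGROUNDS —
# the site transporter datum `Ad ∘ U′` in trace-form coordinates, the gauge action `gaugeT (Ad∘u′) (Ad∘U′) = Ad∘(u′U′u′ᴴ)`, and the slots `hTk ∕ hT0 ∕ hΨ ∕ hSin ∕ hSout` of n15-c∕335 for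
# `T := τ_{Ad∘U′}` (= dag-n15-a's `ctauS` of the fine bond field) and a UNITARY cube gauge `u′_k` (dag-n15-c g31, n15-c∕337)

Cell `pub-ymgap`, seat `pub-ymgap-dag-n15-c` (generation g31; R134 (a) seat, strategy s1 «first missing estimate»; HUMAN RULING D-0062; chair R424 venue).
`bears_on: R4∕N15 · K3⁸ SpineGivenEndpointR13SepCoPHV (stmt-QuantumFields-27366)`; filed `--kind proof --supports stmt-QuantumFields-27366 --as helper` — COUNT-NEUTRAL.
Theorems only, 0 `def`, 0 `sorry`; coordinate algebra, NO estimate.  Imports BY NAME n15-c∕336 `…CovariantTwoGridPullbackTwistData` (`ctauS_eq_conj_gaugeT`, `abs_kingStairT_transpose_le_one`,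
`smear_cols_kingStairT_transpose_sub_one_le(_kingPr)`; through it dag-n15-a ✓p793026∕✓p793284) and dag-n15-w2 `…AdjointGaugeAction` (`uN_siteGauge_orthogonal`, `uN_siteGauge_transpose_eq`,
`coordMat_mulLeftRight_mul`).  The coordinate system `e` is Frobenius-scoped as in n15-c∕262 and dag-n15-w3 FILE 53 (the lemmas of dag-n15-w2 are stated in that scope).  Nothing in the tree is
modified, no landed name re-declared.

WHY.  (C5) instantiates n15-c∕335 on the SITE carriers with `T := ctauS (cvM…) L kk r (Ad∘U′)`, the fine unitary bond field `U′` in `Ad`-coordinates, and per cube the unitary gauge `u′_k` of (3.35)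
(`W′_k = coordMat e (Ad_{u′_k})`).  THIS FILE turns n15-c∕336's abstract slots into the `U(m)` ones: `Ad∘U′` is fibrewise orthogonal (`uN_siteGauge_orthogonal`), so `hΨ`; the gauge action on the
datum is the lattice gauge transformation of the bond variables (★ `gaugeT_coordMat_Ad`: `gaugeT (Ad∘u′)(Ad∘U′)_μ(x) = Ad_{u′(x)U′_μ(x)u′(x+e_μ)ᴴ}` — dag-n15-w2's `uN_siteGauge_transpose_eq` +
`coordMat_mulLeftRight_mul`, as in n15-c∕201 `cvT₀_gauge`), so `hTk` reads ★★ `ctauS_coordMat_Ad_eq_conj`: `τ_{Ad∘U′} = M_{(Ad u′)ᵀ}(M_{S_{u′}ᵀ}∘P̂)M_{Ad(u′∘σ)}` with `S_{u′}` the staircase of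
`Ad∘(u′U′u′ᴴ)`; and the stair letters are those of the TRANSFORMED bond variables `u′U′u′ᴴ` — small on the cube's box by (3.35) — (`hSin`∕`hSout` editions).

HONEST FRAMING ∕ LIMITS.  Coordinate algebra over dag-n15-a's ∕ dag-n15-w2's objects; MODEL carriers (King's torus pair); the (3.35) letters themselves are (C6)'s (from `Reg335Cube` per box
+ the covariant fit of pairing (i)); nothing of [B7]∕[B9] asserted ((125) p.36, (3.28)∕(3.31)–(3.32) p.395, (3.35) p.396 = SHAPES).  NE2⁺ NOT PRINTED, NOT proved; N15 of record untouched
(DISCHARGED AS CONSUMED, p687738); K3⁸ OPEN; counts of record UNMOVED (typed 28∕28 · discharged 8∕27); one finite 𝕋⁴ at fixed ε per index — NOT infinite volume, NOT OS on ℝ⁴, NOT a mass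
gap, NOT Clay; R4 closes the conditional finite-𝕋⁴ rung `BalabanLadder.UV` only.  Restate-immune (no Theses import).
-/

noncomputable section

open scoped BigOperators Matrix Matrix.Norms.Frobenius
open Finset

namespace Summit.QuantumFields.YangMills.BalabanUVNodes.N15.CovAvg

open Literature.MathematicalPhysics.QuantumFieldTheory.Balaban1983to89
open Literature.MathematicalPhysics.QuantumFieldTheory.Balaban1983to89.B5Prop11Plancherel (Tor fine unitVec)
open Literature.MathematicalPhysics.QuantumFieldTheory.Balaban1983to89.T4EtaRateCoeffDefect (pull)
open Literature.MathematicalPhysics.QuantumFieldTheory.King1986.Torus (blockOf)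
open Literature.Barriers.QuantumFields (traceForm)
open Summit.QuantumFields.YangMills.BalabanUVNodes.N15.VectorPiece (kingPr)
open Summit.QuantumFields.YangMills.BalabanUVNodes.N15.MatrixSpecies (mmulOp coordMat liftMap)
open Summit.QuantumFields.YangMills.BalabanUVNodes.N15.CurvedSpecies (uN_siteGauge_orthogonal uN_siteGauge_transpose_eq coordMat_mulLeftRight_mul)
open Summit.QuantumFields.YangMills.BalabanUVNodes.N15.CovLandau (gaugeT)

variable {d : ℕ} (M : Fin (d + 1) → ℕ) [∀ μ, NeZero (M μ)] (L k m : ℕ) [NeZero L] {ι : Type} [Fintype ι] [DecidableEq ι] {mm : Type} [Fintype mm] [DecidableEq mm]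
  (e : Matrix mm mm ℂ ≃L[ℝ] (ι → ℝ))

omit [∀ μ, NeZero (M μ)] [NeZero L] in
/-- ★ **THE GAUGE ACTION ON THE DATUM IS THE LATTICE GAUGE TRANSFORMATION OF THE BOND VARIABLES**: `gaugeT (Ad∘u)(Ad∘U)_μ(x) = Ad_{u(x)U_μ(x)u(x+e_μ)ᴴ}` for unitary `u` (n15-c∕201
`cvT₀_gauge` on King's fine torus). [cite: Balaban1985BackgroundPropagators, (3.28) p.395, (3.31) p.395 (shape)] -/
theorem gaugeT_coordMat_Ad (he : ∀ A B : Matrix mm mm ℂ, traceForm A B = e A ⬝ᵥ e B) {u : Tor (fine (L ^ m * L ^ k) M) → Matrix mm mm ℂ} (hu : ∀ x, (u x)ᴴ * u x = 1)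
    (U : Fin (d + 1) → Tor (fine (L ^ m * L ^ k) M) → Matrix mm mm ℂ) :
    gaugeT M (L ^ m * L ^ k) (fun x => coordMat e (ContinuousLinearMap.mulLeftRight ℝ (Matrix mm mm ℂ) (u x) (u x)ᴴ))
        (fun μ x => coordMat e (ContinuousLinearMap.mulLeftRight ℝ (Matrix mm mm ℂ) (U μ x) (U μ x)ᴴ)) =
      fun μ x => coordMat e (ContinuousLinearMap.mulLeftRight ℝ (Matrix mm mm ℂ) (u x * U μ x * (u (x + unitVec (fine (L ^ m * L ^ k) M) μ))ᴴ)
        (u x * U μ x * (u (x + unitVec (fine (L ^ m * L ^ k) M) μ))ᴴ)ᴴ) := by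
  have hT : ∀ x, (coordMat e (ContinuousLinearMap.mulLeftRight ℝ (Matrix mm mm ℂ) (u x) (u x)ᴴ))ᵀ = coordMat e (ContinuousLinearMap.mulLeftRight ℝ (Matrix mm mm ℂ) (u x)ᴴ (u x)) :=
    fun x => uN_siteGauge_transpose_eq e u he hu x
  funext μ x
  simp only [gaugeT]
  rw [hT, coordMat_mulLeftRight_mul, coordMat_mulLeftRight_mul, Matrix.conjTranspose_mul, Matrix.conjTranspose_mul, Matrix.conjTranspose_conjTranspose]

omit [∀ μ, NeZero (M μ)] [NeZero L] in
/-- ★ THE `hΨ` SLOT AT `U(m)`: the King-block staircase of `Ad∘U′` (unitary `U′`) has `|Sᵀ_{ij}| ≤ 1`. [cite: Balaban1985Averaging, (125) p.36 (shape)] -/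
theorem abs_kingStairT_coordMat_Ad_transpose_le_one (he : ∀ A B : Matrix mm mm ℂ, traceForm A B = e A ⬝ᵥ e B) {U : Fin (d + 1) → Tor (fine (L ^ m * L ^ k) M) → Matrix mm mm ℂ}
    (hU : ∀ μ x, (U μ x)ᴴ * U μ x = 1) (p : Tor (fine (L ^ m * L ^ k) M) × Fin (d + 1)) (i j : ι) :
    |(kingStairT M (L ^ m * L ^ k) (L ^ m) (fun μ b => coordMat e (ContinuousLinearMap.mulLeftRight ℝ (Matrix mm mm ℂ) (U μ b.1) (U μ b.1)ᴴ)) p)ᵀ i j| ≤ 1 :=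
  abs_kingStairT_transpose_le_one M (L ^ m * L ^ k) (L ^ m)
    (fun μ q => (uN_siteGauge_orthogonal e (fun b : Tor (fine (L ^ m * L ^ k) M) × Fin (d + 1) => U μ b.1) he (fun b => hU μ b.1) q).2) p i j

/-- ★★ **THE `hTk` SLOT AT `U(m)`**: for a unitary site gauge `u` (the cube's `u′_k`) and ANY bond field `U′` on the fine torus,
`τ_{Ad∘U′} = M_{(Ad u)ᵀ} ∘ (M_{S_uᵀ} ∘ P̂) ∘ M_{Ad(u∘σ)}` with `S_u` the staircase of `Ad∘(uU′uᴴ)` — the stair field of the TRANSFORMED bond variables, small where they are.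
[cite: Balaban1985BackgroundPropagators, (3.31)–(3.32) p.395 (mechanism); King1986, p.664 (pairing)] -/
theorem ctauS_coordMat_Ad_eq_conj (he : ∀ A B : Matrix mm mm ℂ, traceForm A B = e A ⬝ᵥ e B) {u : Tor (fine (L ^ m * L ^ k) M) → Matrix mm mm ℂ} (hu : ∀ x, (u x)ᴴ * u x = 1)
    (U : Fin (d + 1) → Tor (fine (L ^ m * L ^ k) M) → Matrix mm mm ℂ) :
    ctauS M L k m (fun μ x' => coordMat e (ContinuousLinearMap.mulLeftRight ℝ (Matrix mm mm ℂ) (U μ x') (U μ x')ᴴ)) =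
      mmulOp (fun x' => (coordMat e (ContinuousLinearMap.mulLeftRight ℝ (Matrix mm mm ℂ) (u x') (u x')ᴴ))ᵀ) ∘ₗ
        (mmulOp (fun x' => (kingStairT M (L ^ m * L ^ k) (L ^ m)
            (fun μ b => coordMat e (ContinuousLinearMap.mulLeftRight ℝ (Matrix mm mm ℂ) (u b.1 * U μ b.1 * (u (b.1 + unitVec (fine (L ^ m * L ^ k) M) μ))ᴴ)
              (u b.1 * U μ b.1 * (u (b.1 + unitVec (fine (L ^ m * L ^ k) M) μ))ᴴ)ᴴ)) (x', 0))ᵀ) ∘ₗ pull (liftMap (kingPr L k m M) ι)) ∘ₗ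
        mmulOp (fun x => coordMat e (ContinuousLinearMap.mulLeftRight ℝ (Matrix mm mm ℂ) (u (kingSec M L k m x)) (u (kingSec M L k m x))ᴴ)) := by
  have h := ctauS_eq_conj_gaugeT M L k m (W := fun x => coordMat e (ContinuousLinearMap.mulLeftRight ℝ (Matrix mm mm ℂ) (u x) (u x)ᴴ))
    (fun x => (uN_siteGauge_orthogonal e u he hu x).2) (fun μ x' => coordMat e (ContinuousLinearMap.mulLeftRight ℝ (Matrix mm mm ℂ) (U μ x') (U μ x')ᴴ))
  have hD : (fun μ (b : Tor (fine (L ^ m * L ^ k) M) × Fin (d + 1)) => gaugeT M (L ^ m * L ^ k) (fun x => coordMat e (ContinuousLinearMap.mulLeftRight ℝ (Matrix mm mm ℂ) (u x) (u x)ᴴ))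
      (fun μ x' => coordMat e (ContinuousLinearMap.mulLeftRight ℝ (Matrix mm mm ℂ) (U μ x') (U μ x')ᴴ)) μ b.1) =
      fun μ b => coordMat e (ContinuousLinearMap.mulLeftRight ℝ (Matrix mm mm ℂ) (u b.1 * U μ b.1 * (u (b.1 + unitVec (fine (L ^ m * L ^ k) M) μ))ᴴ)
        (u b.1 * U μ b.1 * (u (b.1 + unitVec (fine (L ^ m * L ^ k) M) μ))ᴴ)ᴴ) :=
    funext fun μ => funext fun b => congrFun (congrFun (gaugeT_coordMat_Ad M L k m e he hu U) μ) b.1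
  rw [hD] at h
  exact h

/-- ★ THE `hSin` SLOT AT `U(m)`: `Σ_j |(ψ(x′)·(S_u(x′)ᵀ − 1))_{ij}| ≤ (1+ρ)^{(d+1)(L^m−1)} − 1` for `|ψ| ≤ 1` supported (blockwise) where the TRANSFORMED bond variables `uU′uᴴ` have one-bond
column letters `ρ` in `Ad`-coordinates — (3.35) on the cube's box. [cite: Balaban1985BackgroundPropagators, (3.35) p.396 (mechanism); Balaban1985Averaging, (125) p.36 (shape)] -/
theorem smear_cols_kingStairT_coordMat_Ad_transpose_sub_one_le (hLm : 0 < L ^ m) (u : Tor (fine (L ^ m * L ^ k) M) → Matrix mm mm ℂ)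
    (U : Fin (d + 1) → Tor (fine (L ^ m * L ^ k) M) → Matrix mm mm ℂ) {ρ : ℝ} (hρ : 0 ≤ ρ) (𝔅 : Set (Tor M))
    (hT : ∀ μ y', blockOf (L ^ m * L ^ k) M y' ∈ 𝔅 → ∀ j, ∑ i, |(coordMat e (ContinuousLinearMap.mulLeftRight ℝ (Matrix mm mm ℂ)
      (u y' * U μ y' * (u (y' + unitVec (fine (L ^ m * L ^ k) M) μ))ᴴ) (u y' * U μ y' * (u (y' + unitVec (fine (L ^ m * L ^ k) M) μ))ᴴ)ᴴ) - 1) i j| ≤ ρ)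
    {ψ : Tor (fine (L ^ m * L ^ k) M) → ℝ} (hψ1 : ∀ x', |ψ x'| ≤ 1) (hψ : ∀ x', ψ x' ≠ 0 → blockOf (L ^ m * L ^ k) M x' ∈ 𝔅) (x' : Tor (fine (L ^ m * L ^ k) M)) (i : ι) :
    ∑ j, |(ψ x' • ((kingStairT M (L ^ m * L ^ k) (L ^ m)
      (fun μ b => coordMat e (ContinuousLinearMap.mulLeftRight ℝ (Matrix mm mm ℂ) (u b.1 * U μ b.1 * (u (b.1 + unitVec (fine (L ^ m * L ^ k) M) μ))ᴴ)
        (u b.1 * U μ b.1 * (u (b.1 + unitVec (fine (L ^ m * L ^ k) M) μ))ᴴ)ᴴ)) (x', 0))ᵀ - 1)) i j| ≤ (1 + ρ) ^ ((d + 1) * (L ^ m - 1)) - 1 :=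
  smear_cols_kingStairT_transpose_sub_one_le M L k m hLm hρ 𝔅 hT hψ1 hψ x' i

/-- ★ THE `hSout` SLOT AT `U(m)` (coarse smearing indicator `ψᵒ∘π`). [cite: Balaban1985BackgroundPropagators, (3.35) p.396 (mechanism); King1986, p.664 (pairing)] -/
theorem smear_cols_kingStairT_coordMat_Ad_transpose_sub_one_le_kingPr (hLm : 0 < L ^ m) (u : Tor (fine (L ^ m * L ^ k) M) → Matrix mm mm ℂ)
    (U : Fin (d + 1) → Tor (fine (L ^ m * L ^ k) M) → Matrix mm mm ℂ) {ρ : ℝ} (hρ : 0 ≤ ρ) (𝔅 : Set (Tor M))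
    (hT : ∀ μ y', blockOf (L ^ m * L ^ k) M y' ∈ 𝔅 → ∀ j, ∑ i, |(coordMat e (ContinuousLinearMap.mulLeftRight ℝ (Matrix mm mm ℂ)
      (u y' * U μ y' * (u (y' + unitVec (fine (L ^ m * L ^ k) M) μ))ᴴ) (u y' * U μ y' * (u (y' + unitVec (fine (L ^ m * L ^ k) M) μ))ᴴ)ᴴ) - 1) i j| ≤ ρ)
    {ψo : Tor (fine (L ^ k) M) → ℝ} (hψ1 : ∀ x, |ψo x| ≤ 1) (hψ : ∀ x, ψo x ≠ 0 → blockOf (L ^ k) M x ∈ 𝔅) (x' : Tor (fine (L ^ m * L ^ k) M)) (i : ι) :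
    ∑ j, |(ψo (kingPr L k m M x') • ((kingStairT M (L ^ m * L ^ k) (L ^ m)
      (fun μ b => coordMat e (ContinuousLinearMap.mulLeftRight ℝ (Matrix mm mm ℂ) (u b.1 * U μ b.1 * (u (b.1 + unitVec (fine (L ^ m * L ^ k) M) μ))ᴴ)
        (u b.1 * U μ b.1 * (u (b.1 + unitVec (fine (L ^ m * L ^ k) M) μ))ᴴ)ᴴ)) (x', 0))ᵀ - 1)) i j| ≤ (1 + ρ) ^ ((d + 1) * (L ^ m - 1)) - 1 :=
  smear_cols_kingStairT_transpose_sub_one_le_kingPr M L k m hLm hρ 𝔅 hT hψ1 hψ x' i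

end Summit.QuantumFields.YangMills.BalabanUVNodes.N15.CovAvg

end
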